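import Literature.MathematicalPhysics.QuantumFieldTheory.YangMillsOS
import Literature.MathematicalPhysics.QuantumFieldTheory.LatticeGaugeStaticPotentialProofs
import Literature.MathematicalPhysics.QuantumFieldTheory.WilsonAxisSymmetry
import HarnessLib

/-!
# The uniform lattice mass gap along every coordinate axis

Crux item `stmt-QuantumFields-16192` (`CurvatureAmnesia`), line `WardDefectSketch`, engine prerequisite (IR):
the hypothesis `HasLatticeMassGap r sch Δ` of the crux bounds the connected correlations
`latticeConnectedCorr r.ρ (sch.β k) (2S+1) A.F B.F n = ⟨A · τ_{n e₀} B⟩ − ⟨A⟩⟨B⟩` of every pair of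
gauge-invariant local lattice observables in the Euclidean TIME direction `e₀` only, while the infrared
summability step of the line needs the same decay along EVERY coordinate axis `e_μ`.  The transport is the
exact hypercubic symmetry of Wilson's torus measure: for the transposition `π = (0 μ)`,

* the axis-permuted observable `A ∘ configPermZd π` is again a gauge-invariant local observable
  (`GapTransport.isZdGaugeInvariant_comp_configPermZd`, `GapTransport.exists_species_comp_configPermZd`);
* read on the periodic lift, `configPermZd π` is `configPerm π` of the torus configuration
  (`configPermZd_torusLift`) and conjugates the translation `τ_{n e₀}` into `τ_{n e_μ}`
  (`configPermZd_configShift`, `sitePermZd_single`);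
* Wilson's torus measure is `configPerm π`-invariant (`integral_comp_configPerm_wilsonMeasure`), so the
  time-direction connected correlation of the permuted pair IS the axis-`μ` connected correlation of the
  pair (`GapTransport.latticeConnectedCorr_comp_configPermZd_swap`);

whence `latticeMassGap_allAxes`: the clause `HasLatticeMassGap r sch Δ` applied to the permuted pair gives the
same constant `C`, the same threshold in `k` and the same rate `Δ` along the axis `μ`.

References: K. Osterwalder, E. Seiler, Ann. Phys. 110 (1978) 440, §2; E. Seiler, LNP 159 (1982), Ch. 1–2 (the
Wilson action and the product Haar measure are invariant under the full hypercubic group).  No definition is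
introduced; nothing here touches the line's skeleton.
-/

noncomputable section

namespace Summit.QuantumFields.YangMills.Cruxes.CurvatureAmnesia.WardDefect

open scoped BigOperators Topology SchwartzMap
open Filter MeasureTheory
open Literature.MathematicalPhysics.QuantumLattice Literature.MathematicalPhysics.AQFT
  Literature.MathematicalPhysics.QuantumFieldTheory

namespace GapTransport

variable {G : Type} [Group G] [MeasurableSpace G]

/-- **Axis permutations preserve gauge invariance**: if `F` is invariant under all lattice gauge
transformations of `ℤ⁴`, so is `F ∘ configPermZd π` — the permuted gauge transform `U^g` is the gauge
transform of the permuted configuration by `g ∘ π⁻¹` (`sitePermZd` is additive and maps `eᵢ` to `e_{π i}`).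
[folklore] -/
theorem isZdGaugeInvariant_comp_configPermZd {α : Type*} {F : LGConfig 4 G → α}
    (hF : IsZdGaugeInvariant F) (π : Equiv.Perm (Fin 4)) : IsZdGaugeInvariant (F ∘ configPermZd π) := by
  intro g U
  have hcomm : configPermZd π (gaugeTransformZd g U) =
      gaugeTransformZd (g ∘ sitePermZd π.symm) (configPermZd π U) := by
    funext e
    simp only [configPermZd_apply, gaugeTransformZd, Function.comp_apply, sitePermZd_add,
      sitePermZd_single]
  simp only [Function.comp_apply, hcomm]
  exact hF _ _

/-- **The axis-permuted species exists**: for every gauge-invariant local lattice observable `A` and every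
permutation `π` of the four axes there is a gauge-invariant local lattice observable with underlying function
`A.F ∘ configPermZd π` (cylinder with the permuted support, `IsCylinder.comp_configPermZd`; gauge invariant by
`isZdGaugeInvariant_comp_configPermZd`; the same bound; measurable as a composition). [folklore] -/
theorem exists_species_comp_configPermZd (π : Equiv.Perm (Fin 4)) (A : YMSpecies G) :
    ∃ A' : YMSpecies G, A'.F = A.F ∘ configPermZd π := by
  obtain ⟨C, hC⟩ := A.bounded
  exact ⟨{ F := A.F ∘ configPermZd π
           supp := A.supp.image fun e => (sitePermZd π.symm e.1, π.symm e.2)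
           isCylinder := IsCylinder.comp_configPermZd A.isCylinder π
           gaugeInvariant := isZdGaugeInvariant_comp_configPermZd A.gaugeInvariant π
           bounded := ⟨C, fun U => hC _⟩
           measurable := A.measurable.comp (configPermZd π).measurable }, rfl⟩

variable [TopologicalSpace G] [IsTopologicalGroup G] [CompactSpace G] [BorelSpace G]

/-- **Transport of the connected correlation to the axis `μ`.** For the transposition `π = (0 μ)` and
arbitrary functions `A, B` of the `ℤ⁴` gauge field (`P_π := configPermZd π`), the time-direction connected
correlation of the permuted pair `(A ∘ P_π, B ∘ P_π)` under Wilson's measure on the torus of side `L` equals the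
axis-`μ` connected correlation `⟨A · τ_{n e_μ} B⟩ − ⟨A⟩⟨B⟩` of `(A, B)`: `P_π` of the periodic lift is the lift
of `configPerm π` (`configPermZd_torusLift`), `P_π ∘ τ_{n e₀} = τ_{n e_μ} ∘ P_π` (`configPermZd_configShift`,
`sitePermZd_single`), and `configPerm π` preserves Wilson's torus measure
(`integral_comp_configPerm_wilsonMeasure`; no measurability of `A, B` is needed, `configPerm π` being a
measurable equivalence). [folklore] -/
theorem latticeConnectedCorr_comp_configPermZd_swap {N : ℕ} (ρ : G →* Matrix (Fin N) (Fin N) ℂ)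
    (hρ : Continuous ρ) (β : ℝ) (L : ℕ) [NeZero L] (μ : Fin 4) (A B : LGConfig 4 G → ℝ) (n : ℕ) :
    latticeConnectedCorr ρ β L (A ∘ configPermZd (Equiv.swap 0 μ)) (B ∘ configPermZd (Equiv.swap 0 μ)) n =
      (∫ U, A (torusLift L U) * B (configShift (-Pi.single μ (n : ℤ)) (torusLift L U))
          ∂(wilsonMeasure (d := 4) (L := L) ρ β)) -
        (∫ U, A (torusLift L U) ∂(wilsonMeasure (d := 4) (L := L) ρ β)) *
          ∫ U, B (torusLift L U) ∂(wilsonMeasure (d := 4) (L := L) ρ β) := by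
  unfold latticeConnectedCorr
  simp only [Function.comp_apply, configPermZd_configShift, configPermZd_torusLift, sitePermZd_neg,
    sitePermZd_single, Equiv.swap_apply_left]
  rw [integral_comp_configPerm_wilsonMeasure ρ hρ β (Equiv.swap 0 μ)
      (fun U => A (torusLift L U) * B (configShift (-Pi.single μ (n : ℤ)) (torusLift L U))),
    integral_comp_configPerm_wilsonMeasure ρ hρ β (Equiv.swap 0 μ) (fun U => A (torusLift L U)),
    integral_comp_configPerm_wilsonMeasure ρ hρ β (Equiv.swap 0 μ) (fun U => B (torusLift L U))]

end GapTransport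

/-- **The uniform lattice mass gap holds along every coordinate axis** (engine prerequisite (IR) of line
`WardDefectSketch`, crux `CurvatureAmnesia`): if `HasLatticeMassGap r sch Δ` (time-direction connected
correlations of all pairs of gauge-invariant local lattice observables decay at rate `Δ` in physical units,
eventually in `k`, on all tori of side `2S+1 ≥ 2L_k+1`, for separations `n ≤ S`), then for every axis `μ` and
every pair `A, B` the axis-`μ` connected correlations `⟨A · τ_{n e_μ} B⟩_{k,S} − ⟨A⟩_{k,S}⟨B⟩_{k,S}` obey the same
bound `C e^{−Δ a_k n}` — apply the clause to the pair permuted by the transposition `(0 μ)`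
(`GapTransport.exists_species_comp_configPermZd`) and transport by the exact hypercubic symmetry of Wilson's
torus measure (`GapTransport.latticeConnectedCorr_comp_configPermZd_swap`). [folklore] -/
theorem latticeMassGap_allAxes : ∀ (G : Type) [Group G] [TopologicalSpace G] [IsTopologicalGroup G] [CompactSpace G] [MeasurableSpace G] [BorelSpace G] (r : LatticeRep G) (sch : SpeciesScheme (YMSpecies G)) (Δ : ℝ), HasLatticeMassGap r sch Δ → ∀ (μ : Fin 4) (A B : YMSpecies G), ∃ C : ℝ, ∀ᶠ k in atTop, ∀ S : ℕ, sch.L k ≤ S → ∀ n : ℕ, n ≤ S → |(∫ U, A.F (torusLift (2 * S + 1) U) * B.F (configShift (-Pi.single μ (n : ℤ)) (torusLift (2 * S + 1) U)) ∂(wilsonMeasure (d := 4) (L := 2 * S + 1) r.ρ (sch.β k))) - (∫ U, A.F (torusLift (2 * S + 1) U) ∂(wilsonMeasure (d := 4) (L := 2 * S + 1) r.ρ (sch.β k))) * ∫ U, B.F (torusLift (2 * S + 1) U) ∂(wilsonMeasure (d := 4) (L := 2 * S + 1) r.ρ (sch.β k))| ≤ C * Real.exp (-(Δ * (sch.a k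 * n))) := by
  intro G _ _ _ _ _ _ r sch Δ hgap μ A B
  obtain ⟨A', hA'⟩ := GapTransport.exists_species_comp_configPermZd (Equiv.swap 0 μ) A
  obtain ⟨B', hB'⟩ := GapTransport.exists_species_comp_configPermZd (Equiv.swap 0 μ) B
  obtain ⟨C, hC⟩ := hgap A' B'
  refine ⟨C, hC.mono fun k hk S hS n hn => ?_⟩
  have h := hk S hS n hn
  rw [hA', hB', GapTransport.latticeConnectedCorr_comp_configPermZd_swap r.ρ r.continuous] at h
  exact h

end Summit.QuantumFields.YangMills.Cruxes.CurvatureAmnesia.WardDefect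

end
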